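import Mathlib
import Summits.Langlands.Langlands.Theorems.IrreducibilityBySelfDualityHeckeEigenvalueFieldStubLiftD
import Literature.NumberTheory.Automorphic.ResGLnConeDictionaryCone
import Literature.NumberTheory.Automorphic.ArchimedeanCalculus
import HarnessLib

/-!
# The differential of the lift of a family of cone forms — crux `HeckeEigenvalueField`
(stmt-Langlands-13632), line `Sketch`, stub LIFT-DIFF

Namespace `Summit.Langlands.Langlands.Theorems.HeckeEigenvalueField.Res`.  Theorems only.
For a family `β_c` of `q`-forms on the hermitian space `X = ResGLnCone.hermSpace n K`, the lift
`u(Y)(g, c) = σS(g)⁻¹ β_c(sq g)(tg_g Y₁, …, tg_g Y_q)` to the archimedean group `G_∞ = GL_n(K_∞)` of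
the datum (`sq h = h hᴴ`, `tg h Y = h Y hᴴ + h Yᴴ hᴴ`, given abstractly as in LIFT-D) satisfies, for
hermitian `Y₀, …, Y_q`,
`∑ᵢ (-1)ⁱ ( d/dt|₀ u(Y_{∖i})(g e^{tYᵢ}, c) + σ𝔤S(Yᵢ) u(Y_{∖i})(g, c) ) = σS(g)⁻¹ (dβ_c)(sq g)(tg_g Y₀, …, tg_g Y_q)`
(`stub_lift_differential`): the Leibniz rule for `t ↦ σS(g e^{tYᵢ})⁻¹ · Fᵢ(t)` in the
finite-dimensional coefficient module (`hasDerivAt_apply_of_hasDerivAt_pointwise`, through a real basis),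
whose `σ`-term `-σ𝔤S(Yᵢ) σS(g)⁻¹ Fᵢ(0)` cancels the module term, and the landed LIFT-D
(`stub_extDeriv_hermSquare_leftInvariant`) for `∑ (-1)ⁱ Fᵢ'(0) = dβ_c(sq g)(tg_g Y)`.
Reference: A. Borel, N. Wallach, *Continuous cohomology, discrete subgroups, and representations of
reductive groups*, 2nd ed. (2000), VII 2.2–2.5. [BorelWallach2000]
-/

set_option linter.dupNamespace false -- project-wide: `Summit.Langlands.Langlands` is the mandated namespace

noncomputable section

-- as in the LIFT-D file: product-topology vs normed instance paths on `M_n(K_∞)` unfold `Matrix`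
set_option backward.isDefEq.respectTransparency false

open scoped Topology Classical Matrix
open Filter NumberField NumberField.mixedEmbedding
open Literature.NumberTheory.Automorphic Literature.NumberTheory.Automorphic.RealMatrixGroup

namespace Summit.Langlands.Langlands.Theorems.HeckeEigenvalueField.Res

/-- **Leibniz rule for `t ↦ L(t) φ(t)` in a finite-dimensional complex space, from the POINTWISE
derivative of the operator curve**: if `t ↦ L t v` has derivative `-T₁ (T₂ v)` at `0` for every `v`
and `φ` has derivative `φ'` at `0`, then `t ↦ L t (φ t)` has derivative `L 0 φ' - T₁ (T₂ (φ 0))` at `0`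
(expand `φ t` in a real basis and use the scalar Leibniz rule coordinatewise). [folklore] -/
theorem hasDerivAt_apply_of_hasDerivAt_pointwise {E : Type*} [NormedAddCommGroup E] [NormedSpace ℂ E]
    [FiniteDimensional ℂ E] {L : ℝ → Module.End ℂ E} {T₁ T₂ : Module.End ℂ E}
    (hL : ∀ v, HasDerivAt (fun t => L t v) (-(T₁ (T₂ v))) 0)
    {φ : ℝ → E} {φ' : E} (hφ : HasDerivAt φ φ' 0) :
    HasDerivAt (fun t => L t (φ t)) (L 0 φ' - T₁ (T₂ (φ 0))) 0 := by
  let b := Module.finBasis ℝ E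
  have hsum : ∀ (A : Module.End ℂ E) (x : E), ∑ k, b.repr x k • A (b k) = A x := by
    intro A x
    conv_rhs => rw [← b.sum_repr x]
    rw [map_sum]
    exact Finset.sum_congr rfl fun k _ => (A.map_smul_of_tower _ _).symm
  have h2 : ∀ k, HasDerivAt (fun t => b.repr (φ t) k) (b.repr φ' k) 0 := fun k => by
    simpa [Function.comp_def] using
      (LinearMap.toContinuousLinearMap (b.coord k)).hasFDerivAt.comp_hasDerivAt 0 hφ
  have h3 := HasDerivAt.fun_sum fun k (_ : k ∈ Finset.univ) => (h2 k).fun_smul (hL (b k))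
  have h4 : HasDerivAt (fun t => L t (φ t))
      (∑ k, (b.repr (φ 0) k • -(T₁ (T₂ (b k))) + b.repr φ' k • L 0 (b k))) 0 :=
    h3.congr_of_eventuallyEq (Eventually.of_forall fun t => (hsum (L t) (φ t)).symm)
  have h5 : ∑ k, b.repr (φ 0) k • T₁ (T₂ (b k)) = T₁ (T₂ (φ 0)) := by
    simpa only [Module.End.mul_apply] using hsum (T₁ * T₂) (φ 0)
  refine h4.congr_deriv ?_
  simp only [smul_neg, Finset.sum_add_distrib, Finset.sum_neg_distrib, hsum, h5]
  abel

set_option maxHeartbeats 400000 in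
-- the statement alone elaborates in > 100000 heartbeats (datum-typed `σS`, `q + 1` curves); as LIFT-D
/-- **Stub LIFT-DIFF — the differential of the lift is the twisted exterior derivative** (the cone
dictionary is a cochain map, read backwards).  With `u(Y)(g,c) = σS(g)⁻¹ β_c(sq g)(tg_g Y)` as in
LIFT-INV, for hermitian `Y₀, …, Y_q`:
`∑ᵢ (-1)ⁱ ( d/dt|₀ u(Y_{∖i})(g e^{tYᵢ}, c) + σ𝔤S(Yᵢ) u(Y_{∖i})(g, c) ) = σS(g)⁻¹ (dβ_c)(sq g)(tg_g Y₀, …, tg_g Y_q)`: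
Leibniz for `t ↦ σS(g e^{tYᵢ})⁻¹ · β(…)`, whose `σ`-term `-σ𝔤S(Yᵢ) σS(g)⁻¹ β(…)` (`hσd`) cancels the
tensor-module term, and the landed LIFT-D (`stub_extDeriv_hermSquare_leftInvariant`) for the `β`-term.
[cite: BorelWallach2000, VII 2.2–2.5] -/
theorem stub_lift_differential {n : ℕ} {K : Type} [Field K] [NumberField K]
    (hcpt : isCompact_glFiniteIntegralLevel n K) (𝔫 : Ideal (𝓞 K))
    (S : Finset {w : InfinitePlace K // w.IsReal}) (lam : (K →+* ℂ) → Fin n → ℤ) {q : ℕ}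
    (sq : (AutomorphyDatum.gl n K hcpt).arch.carrier → ResGLnCone.hermSpace n K)
    (hsq : ∀ h : (AutomorphyDatum.gl n K hcpt).arch.carrier,
      (sq h : Matrix (Fin n) (Fin n) (mixedSpace K)) =
        ((h : GL (Fin n) (mixedSpace K)) : Matrix (Fin n) (Fin n) (mixedSpace K)) *
          (((h : GL (Fin n) (mixedSpace K)) : Matrix (Fin n) (Fin n) (mixedSpace K)))ᴴ)
    (tg : (AutomorphyDatum.gl n K hcpt).arch.carrier → (AutomorphyDatum.gl n K hcpt).arch.lie →
      ResGLnCone.hermSpace n K)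
    (htg : ∀ (h : (AutomorphyDatum.gl n K hcpt).arch.carrier) (Y : (AutomorphyDatum.gl n K hcpt).arch.lie),
      (tg h Y : Matrix (Fin n) (Fin n) (mixedSpace K)) =
        ((h : GL (Fin n) (mixedSpace K)) : Matrix (Fin n) (Fin n) (mixedSpace K)) *
            (Y : Matrix (Fin n) (Fin n) (mixedSpace K)) *
            (((h : GL (Fin n) (mixedSpace K)) : Matrix (Fin n) (Fin n) (mixedSpace K)))ᴴ +
          ((h : GL (Fin n) (mixedSpace K)) : Matrix (Fin n) (Fin n) (mixedSpace K)) *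
            (Y : Matrix (Fin n) (Fin n) (mixedSpace K))ᴴ *
            (((h : GL (Fin n) (mixedSpace K)) : Matrix (Fin n) (Fin n) (mixedSpace K)))ᴴ)
    (β : (BigHeckeGLn.FiniteAdelicGL n K ⧸ ResGLnCohomology.level n K 𝔫) →
      ResGLnCone.hermSpace n K → ResGLnCone.hermSpace n K [⋀^Fin q]→L[ℝ] ResGLnCohomology.CoeffModule ℂ n K lam)
    (hσd : ∀ (g : (AutomorphyDatum.gl n K hcpt).arch.carrier) (Y : (AutomorphyDatum.gl n K hcpt).arch.lie)
      (v : ResGLnCohomology.CoeffModule ℂ n K lam),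
      HasDerivAt (fun t : ℝ => ConeDictionary.σS hcpt S lam
          (g * (AutomorphyDatum.gl n K hcpt).arch.expMem (t • Y))⁻¹ v)
        (-(ConeDictionary.σ𝔤S hcpt lam Y (ConeDictionary.σS hcpt S lam g⁻¹ v))) 0)
    (u : (Fin q → (AutomorphyDatum.gl n K hcpt).arch.lie) → (AutomorphyDatum.gl n K hcpt).arch.carrier →
      BigHeckeGLn.FiniteAdelicGL n K → ResGLnCohomology.CoeffModule ℂ n K lam)
    (hu : ∀ Yt g c, u Yt g c = ConeDictionary.σS hcpt S lam g⁻¹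
      (β (c : BigHeckeGLn.FiniteAdelicGL n K ⧸ ResGLnCohomology.level n K 𝔫) (sq g) (fun i => tg g (Yt i))))
    (g : (AutomorphyDatum.gl n K hcpt).arch.carrier) (c : BigHeckeGLn.FiniteAdelicGL n K)
    (hβ : DifferentiableAt ℝ (β (c : BigHeckeGLn.FiniteAdelicGL n K ⧸ ResGLnCohomology.level n K 𝔫)) (sq g))
    (Y : Fin (q + 1) → (AutomorphyDatum.gl n K hcpt).arch.lie)
    (hY : ∀ i, ((Y i : (AutomorphyDatum.gl n K hcpt).arch.lie) : Matrix (Fin n) (Fin n) (mixedSpace K))ᴴ =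
      ((Y i : (AutomorphyDatum.gl n K hcpt).arch.lie) : Matrix (Fin n) (Fin n) (mixedSpace K))) :
    ∑ i : Fin (q + 1), ((-1 : ℂ) ^ (i : ℕ)) •
        (deriv (fun t : ℝ => u (fun j => Y (i.succAbove j))
            (g * (AutomorphyDatum.gl n K hcpt).arch.expMem (t • Y i)) c) 0 +
          ConeDictionary.σ𝔤S hcpt lam (Y i) (u (fun j => Y (i.succAbove j)) g c)) =
      ConeDictionary.σS hcpt S lam g⁻¹
        (extDeriv (β (c : BigHeckeGLn.FiniteAdelicGL n K ⧸ ResGLnCohomology.level n K 𝔫)) (sq g)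
          (fun i => tg g (Y i))) := by
  -- (0) the (hermitian) derivatives of the tangent vectors `t ↦ tg (g e^{tYᵢ}) Y_l` at `0`
  have hUmem : ∀ a l : Fin (q + 1),
      g.1.1 * (Y a).1 * (Y l).1 * g.1.1ᴴ + g.1.1 * (Y l).1 * (Y a).1ᴴ * g.1.1ᴴ +
          g.1.1 * (Y a).1 * (Y l).1ᴴ * g.1.1ᴴ + g.1.1 * (Y l).1ᴴ * (Y a).1ᴴ * g.1.1ᴴ ∈
        ResGLnCone.hermSpace n K := by
    intro a l
    rw [ResGLnCone.mem_hermSpace_iff]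
    simp only [Matrix.conjTranspose_add, Matrix.conjTranspose_mul, Matrix.conjTranspose_conjTranspose]
    noncomm_ring
  have hw : ∀ i l : Fin (q + 1), HasDerivAt
      (fun t : ℝ => tg (g * (AutomorphyDatum.gl n K hcpt).arch.expMem (t • Y i)) (Y l)) ⟨_, hUmem i l⟩ 0 :=
    fun i l => hasDerivAt_tg_mul_expMem _ tg htg g (Y i) (Y l) ⟨_, hUmem i l⟩ rfl
  -- (1) the hermitian squares `t ↦ sq (g e^{tYᵢ})` have derivative `tg g Yᵢ` at `0`
  have hc : ∀ i : Fin (q + 1), HasDerivAt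
      (fun t : ℝ => sq (g * (AutomorphyDatum.gl n K hcpt).arch.expMem (t • Y i))) (tg g (Y i)) 0 :=
    fun i => hasDerivAt_sq_mul_expMem _ sq hsq g (Y i) (tg g (Y i)) (htg g (Y i))
  -- (2) the curves `Fᵢ t = β_c (sq (g e^{tYᵢ})) (tg (g e^{tYᵢ}) Y_{∖i})` are differentiable at `0`
  have hFd : ∀ i : Fin (q + 1), DifferentiableAt ℝ
      (fun t : ℝ => β (c : BigHeckeGLn.FiniteAdelicGL n K ⧸ ResGLnCohomology.level n K 𝔫)
        (sq (g * (AutomorphyDatum.gl n K hcpt).arch.expMem (t • Y i)))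
        (fun j => tg (g * (AutomorphyDatum.gl n K hcpt).arch.expMem (t • Y i)) (Y (i.succAbove j)))) 0 := by
    intro i
    have hβc : HasDerivAt
        (fun t : ℝ => β (c : BigHeckeGLn.FiniteAdelicGL n K ⧸ ResGLnCohomology.level n K 𝔫)
          (sq (g * (AutomorphyDatum.gl n K hcpt).arch.expMem (t • Y i))))
        (fderiv ℝ (β (c : BigHeckeGLn.FiniteAdelicGL n K ⧸ ResGLnCohomology.level n K 𝔫)) (sq g)
          (tg g (Y i))) 0 :=
      hβ.hasFDerivAt.comp_hasDerivAt_of_eq 0 (hc i) (by rw [mul_expMem_zero_smul])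
    exact (hasDerivAt_continuousAlternatingMap_apply hβc (fun j => hw i (i.succAbove j))).differentiableAt
  -- (3) LIFT-D for the right-hand side, then summand by summand
  rw [stub_extDeriv_hermSquare_leftInvariant hcpt _ sq hsq tg htg g hβ Y hY,
    map_sum (ConeDictionary.σS hcpt S lam g⁻¹)]
  refine Finset.sum_congr rfl fun i _ => ?_
  -- Leibniz for `t ↦ σS(g e^{tYᵢ})⁻¹ (Fᵢ t)`
  have hL := hasDerivAt_apply_of_hasDerivAt_pointwise (hσd g (Y i)) (hFd i).hasDerivAt
  rw [mul_expMem_zero_smul] at hL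
  have hL' := hL.congr_of_eventuallyEq
    (f₁ := fun t : ℝ => u (fun j => Y (i.succAbove j))
      (g * (AutomorphyDatum.gl n K hcpt).arch.expMem (t • Y i)) c)
    (Eventually.of_forall fun t => hu _ _ _)
  rw [hL'.deriv, hu, sub_add_cancel, LinearMap.map_smul_of_tower, ← Complex.coe_smul, Complex.ofReal_pow,
    Complex.ofReal_neg, Complex.ofReal_one]

end Summit.Langlands.Langlands.Theorems.HeckeEigenvalueField.Res

end
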